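import Summits.QuantumFields.YangMills.Theorems.ParabolicTrajectoryTunedSequenceExistsQFemtoBridge

/-!
# Crux `TunedSequenceExists` (stmt-QuantumFields-10524) vs the sibling crux `FemtoCurvatureTwoPointC`
# (stmt-QuantumFields-16204): no femto torus witnesses the crux (the `Q`-channel)
# (lead c5 of line `fixed-aspect-window`, `--supports stmt-QuantumFields-10524`)

The sibling tier-deciding crux, unbundled at given data as `CruxCAtWith r a Γ β₀ ℓ₀ c C` (`…QFemtoBridge`), controls the
rescaled time-axis autocorrelation `D⁸ ⟨Q ; τ_D Q⟩_{β,S}` of the time-zero plaquette `Q = spatialPlaquette r` two-sidedly by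
`Γ(D · a β)` on every FEMTO torus (`β ≥ β₀`, `S · a β ≤ ℓ₀`, `1 ≤ D`, `8 D ≤ S`; `axis_window_of_cruxCAtWith`), and the
shape is forced to vanish at `0+` (`gamma_tendsto_zero_of_cruxCAtWith`, needs the unit map `a` continuous). This file
draws the two consequences that make precise "no perturbative (femto) torus can witness the crux":

* `rescaledQ_lt_of_cruxCAtWith` — uniform smallness: for every `ε > 0` there is `δ > 0` with `D⁸ ⟨Q;τ_DQ⟩_{β,S} < ε`
  on every femto torus at every admissible separation of physical size `D · a β < δ`;
* `femtoQ_le_of_cruxCAtWith` — (a) femto tori of LARGE ASPECT carry uniformly small rescaled `Q`-correlators: there is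
  an aspect floor `A` such that on every femto torus of side `2 L₁ D + 1` with `L₁ ≥ A` the rescaled correlator at
  separation `D` is `≤ ε` (because `D · a β ≤ ℓ₀ D / (2 L₁ D + 1) < ℓ₀ / (2 L₁) < δ`);
* `eventually_not_femto_of_tunedQ` — (b) along ANY tuned `Q`-witness of the crux (`M`-adic shape, `β_k → ∞`,
  rescaled correlator `→ θ > 0` on the tori of side `sch.side k = 2 L_k + 1`) the tori are eventually NON-femto in the
  sibling's units: `ℓ₀ < (2 L_k + 1) · a(β_k)` for all large `k` (the aspect `L_k / M^{n_k} → ∞` by `a_k L_k → ∞`, so a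
  femto torus would force the correlator below `θ / 2`).

Consequence for the planner (recorded in `…QFemtoBridge`/`…QFemtoReduction`): the `Q`-restated crux needs a
thermodynamic-limit child (`VolumeMonotoneQRel`) BESIDES the sibling crux — a necessity, not an artefact of the split.
-/

noncomputable section

open Filter Topology MeasureTheory
open Literature.MathematicalPhysics.QuantumFieldTheory Literature.MathematicalPhysics.QuantumLattice

namespace Summit.QuantumFields.YangMills.Theorems.TunedSequenceExists.QFemto

open RPDiagonalVariant (spatialPlaquette)
open Negative.AtZeroFalse (eventually_sep_le_L)

variable {G : Type} [Group G] [TopologicalSpace G] [IsTopologicalGroup G] [CompactSpace G]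
  [MeasurableSpace G] [BorelSpace G]

/-- **Uniform smallness on femto tori at small physical separation.** Under `CruxCAtWith r a Γ β₀ ℓ₀ c C` with `a`
continuous, for every `ε > 0` there is `δ > 0` such that on every femto torus (`β ≥ β₀`, `S · a β ≤ ℓ₀`) every
separation `1 ≤ D`, `8 D ≤ S` of physical size `D · a β < δ` has rescaled `Q`-correlator `D⁸ ⟨Q;τ_DQ⟩_{β,S} < ε`
(the clause-1 ceiling `≤ C · Γ(D · a β) ≤ max C 1 · Γ(D · a β)` and the forced `Γ(0+) = 0`). -/
theorem rescaledQ_lt_of_cruxCAtWith (r : LatticeRep G) {a Γ : ℝ → ℝ} {β₀ ℓ₀ c C : ℝ}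
    (h : CruxCAtWith r a Γ β₀ ℓ₀ c C) (ha : Continuous a) {ε : ℝ} (hε : 0 < ε) :
    ∃ δ : ℝ, 0 < δ ∧ ∀ (S : ℕ) [NeZero S] (β : ℝ) (D : ℕ), β₀ ≤ β → (S : ℝ) * a β ≤ ℓ₀ → 1 ≤ D →
      8 * D ≤ S → (D : ℝ) * a β < δ →
        (D : ℝ) ^ 8 * latticeConnectedCorr r.ρ β S (spatialPlaquette r) (spatialPlaquette r) D < ε := by
  have hapos := h.2.2.1
  have hΓ := h.2.2.2.2.1
  -- absorb the sign of `C` into `K = max C 1 > 0`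
  set K : ℝ := max C 1 with hK_def
  have hK : 0 < K := lt_of_lt_of_le one_pos (le_max_right _ _)
  have hCK : C ≤ K := le_max_left _ _
  have hεK : 0 < ε / K := div_pos hε hK
  obtain ⟨δ, hδ, hΓδ⟩ :=
    Metric.tendsto_nhdsWithin_nhds.1 (gamma_tendsto_zero_of_cruxCAtWith r h ha) (ε / K) hεK
  refine ⟨δ, hδ, fun S _ β D hβ hfem hD1 hDS hsδ => ?_⟩
  -- the physical separation `s = D · a β ∈ (0, ℓ₀]`, `s < δ`
  set s : ℝ := (D : ℝ) * a β with hs_def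
  have hDpos : (0 : ℝ) < D := Nat.cast_pos.2 hD1
  have hs : 0 < s := mul_pos hDpos (hapos β)
  have hsℓ : s ≤ ℓ₀ := by
    have hDS' : (D : ℝ) ≤ S := by exact_mod_cast le_trans (by omega : D ≤ 8 * D) hDS
    calc s = (D : ℝ) * a β := rfl
      _ ≤ (S : ℝ) * a β := mul_le_mul_of_nonneg_right hDS' (hapos β).le
      _ ≤ ℓ₀ := hfem
  have hΓs : Γ s < ε / K := by
    have h1 := hΓδ (Set.mem_Ioi.2 hs) (by rwa [dist_zero_right, Real.norm_eq_abs, abs_of_pos hs])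
    rw [dist_zero_right, Real.norm_eq_abs] at h1
    exact (abs_lt.1 h1).2
  have hΓpos : 0 < Γ s := (hΓ s hs hsℓ).1
  -- clause 1 (upper half) on the femto torus of side `S` at separation `D`
  have hwin := (axis_window_of_cruxCAtWith r h S hβ hfem hD1 hDS).2
  calc (D : ℝ) ^ 8 * latticeConnectedCorr r.ρ β S (spatialPlaquette r) (spatialPlaquette r) D
      ≤ C * Γ s := hwin
    _ ≤ K * Γ s := mul_le_mul_of_nonneg_right hCK hΓpos.le
    _ < K * (ε / K) := mul_lt_mul_of_pos_left hΓs hK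
    _ = ε := mul_div_cancel₀ ε hK.ne'

/-- **(a) Femto tori of large aspect carry uniformly small rescaled `Q`-correlators.** Under
`CruxCAtWith r a Γ β₀ ℓ₀ c C` with `a` continuous, for every `ε > 0` there is an aspect floor `A` such that for all
`L₁ ≥ A`, `β ≥ β₀`, `D ≥ 1` with the torus of side `2 L₁ D + 1` femto (`(2 L₁ D + 1) · a β ≤ ℓ₀`):
`D⁸ ⟨Q ; τ_D Q⟩_{β, 2 L₁ D + 1} ≤ ε`. (The physical separation is `D · a β ≤ ℓ₀ D / (2 L₁ D + 1) < ℓ₀ / (2 L₁)`, small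
for large aspect; then `rescaledQ_lt_of_cruxCAtWith`.) -/
theorem femtoQ_le_of_cruxCAtWith (r : LatticeRep G) {a Γ : ℝ → ℝ} {β₀ ℓ₀ c C : ℝ}
    (h : CruxCAtWith r a Γ β₀ ℓ₀ c C) (ha : Continuous a) {ε : ℝ} (hε : 0 < ε) :
    ∃ A : ℕ, ∀ L₁ : ℕ, A ≤ L₁ → ∀ (β : ℝ) (D : ℕ), β₀ ≤ β → 1 ≤ D →
      ((2 * (L₁ * D) + 1 : ℕ) : ℝ) * a β ≤ ℓ₀ →
        (D : ℝ) ^ 8 * latticeConnectedCorr r.ρ β (2 * (L₁ * D) + 1) (spatialPlaquette r) (spatialPlaquette r) D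
          ≤ ε := by
  obtain ⟨δ, hδ, hsmall⟩ := rescaledQ_lt_of_cruxCAtWith r h ha hε
  -- aspect floor: `L₁ ≥ 4` (so that `8 D ≤ 2 L₁ D + 1`) and `ℓ₀ / (2 L₁) < δ`
  obtain ⟨N, hN⟩ := exists_nat_gt (ℓ₀ / (2 * δ))
  refine ⟨max 4 N, fun L₁ hL₁ β D hβ hD1 hfem => ?_⟩
  have hL4 : 4 ≤ L₁ := (le_max_left _ _).trans hL₁
  have hLN : N ≤ L₁ := (le_max_right _ _).trans hL₁
  have h8 : 8 * D ≤ 2 * (L₁ * D) + 1 := by nlinarith [hL4, Nat.zero_le D]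
  have hDpos : (0 : ℝ) < D := Nat.cast_pos.2 hD1
  have hδL : ℓ₀ < 2 * δ * L₁ := by
    have h1 : ℓ₀ / (2 * δ) < (L₁ : ℝ) := hN.trans_le (by exact_mod_cast hLN)
    have h2 := (div_lt_iff₀ (by positivity : (0 : ℝ) < 2 * δ)).1 h1
    linarith
  -- the physical separation `D · a β < δ`
  have hsδ : (D : ℝ) * a β < δ := by
    have hS : ((2 * (L₁ * D) + 1 : ℕ) : ℝ) = 2 * (L₁ : ℝ) * D + 1 := by push_cast; ring
    have hfem' := hfem
    rw [hS] at hfem'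
    have hSpos : (0 : ℝ) < 2 * (L₁ : ℝ) * D + 1 := by positivity
    have h1 : (D : ℝ) * a β * (2 * (L₁ : ℝ) * D + 1) ≤ D * ℓ₀ := by
      have := mul_le_mul_of_nonneg_left hfem' hDpos.le
      linarith
    have h2 : (D : ℝ) * ℓ₀ < δ * (2 * (L₁ : ℝ) * D + 1) := by
      nlinarith [mul_pos (sub_pos.2 hδL) hDpos]
    by_contra hge
    push Not at hge
    have h3 : δ * (2 * (L₁ : ℝ) * D + 1) ≤ (D : ℝ) * a β * (2 * (L₁ : ℝ) * D + 1) :=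
      mul_le_mul_of_nonneg_right hge hSpos.le
    linarith
  exact (hsmall (2 * (L₁ * D) + 1) β D hβ hfem hD1 h8 hsδ).le

/-- **(b) Along any tuned `Q`-witness the tori are eventually non-femto.** Under `CruxCAtWith r a Γ β₀ ℓ₀ c C` with
`a` continuous: if a Wilson scheme `sch` with `M`-adic shape `a_k = M^{-n_k}` and `β_k → ∞` has rescaled
`Q`-correlator `(M^{n_k})⁸ ⟨Q ; τ_{M^{n_k}} Q⟩_{β_k, 2L_k+1} → θ > 0`, then eventually `ℓ₀ < (2 L_k + 1) · a(β_k)`: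
the witnessing tori are NOT femto in the sibling's units. (Eventually `β_k ≥ β₀`, `N · M^{n_k} ≤ L_k` for any `N`
(`a_k L_k → ∞`), and the correlator exceeds `θ / 2`; were the torus femto, the physical separation would be
`M^{n_k} · a(β_k) ≤ ℓ₀ M^{n_k} / (2 L_k + 1) < δ`, forcing the correlator below `θ / 2` by
`rescaledQ_lt_of_cruxCAtWith`.) -/
theorem eventually_not_femto_of_tunedQ (r : LatticeRep G) {a Γ : ℝ → ℝ} {β₀ ℓ₀ c C : ℝ}
    (h : CruxCAtWith r a Γ β₀ ℓ₀ c C) (ha : Continuous a) {M : ℕ} {θ : ℝ} (hθ : 0 < θ)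
    (sch : SpeciesScheme (YMSpecies G)) (n : ℕ → ℕ) (hshape : ∀ k, sch.a k = ((M : ℝ) ^ n k)⁻¹)
    (hβ : Tendsto sch.β atTop atTop)
    (hlim : Tendsto (fun k => ((M : ℝ) ^ n k) ^ 8 *
      latticeConnectedCorr r.ρ (sch.β k) (sch.side k) (spatialPlaquette r) (spatialPlaquette r) (M ^ n k))
      atTop (𝓝 θ)) :
    ∀ᶠ k in atTop, ℓ₀ < (sch.side k : ℝ) * a (sch.β k) := by
  have hθ2 : 0 < θ / 2 := by positivity
  obtain ⟨δ, hδ, hsmall⟩ := rescaledQ_lt_of_cruxCAtWith r h ha hθ2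
  -- aspect `N` with `ℓ₀ / (2 N) < δ`
  obtain ⟨N, hN⟩ := exists_nat_gt (ℓ₀ / (2 * δ))
  have hδN : ℓ₀ < 2 * δ * N := by
    have h2 := (div_lt_iff₀ (by positivity : (0 : ℝ) < 2 * δ)).1 hN
    linarith
  have hθθ : θ / 2 < θ := by linarith
  filter_upwards [tendsto_atTop.1 hβ β₀, eventually_sep_le_L sch hshape 8, eventually_sep_le_L sch hshape N,
    hlim.eventually (lt_mem_nhds hθθ)] with k hk₀ hk8 hkN hku
  have hku' : θ / 2 < ((M : ℝ) ^ n k) ^ 8 *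
      latticeConnectedCorr r.ρ (sch.β k) (sch.side k) (spatialPlaquette r) (spatialPlaquette r) (M ^ n k) := hku
  rw [← not_le]
  intro hfem
  -- the separation `D = M^{n_k} ≥ 1` (the shape clause and `a_k > 0`)
  have hDpos : (0 : ℝ) < (M : ℝ) ^ n k := by
    have h1 := sch.a_pos k
    rw [hshape k, inv_pos] at h1
    exact h1
  have hD0 : 0 < M ^ n k := by exact_mod_cast hDpos
  have hDS : 8 * M ^ n k ≤ sch.side k := by
    show 8 * M ^ n k ≤ 2 * sch.L k + 1
    omega
  have hcast : ((M ^ n k : ℕ) : ℝ) = (M : ℝ) ^ n k := Nat.cast_pow M (n k)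
  have hS : ((sch.side k : ℕ) : ℝ) = 2 * (sch.L k : ℝ) + 1 := by
    simp [SpeciesScheme.side]
  -- were the torus femto, the physical separation would be `< δ`
  have hsδ : ((M ^ n k : ℕ) : ℝ) * a (sch.β k) < δ := by
    rw [hcast]
    have hfem' := hfem
    rw [hS] at hfem'
    have hkN' : (N : ℝ) * (M : ℝ) ^ n k ≤ sch.L k := by exact_mod_cast hkN
    have hLpos : (0 : ℝ) < 2 * (sch.L k : ℝ) + 1 := by positivity
    by_contra hge
    push Not at hge
    have h1 : δ * (2 * (sch.L k : ℝ) + 1) ≤ (M : ℝ) ^ n k * a (sch.β k) * (2 * (sch.L k : ℝ) + 1) :=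
      mul_le_mul_of_nonneg_right hge hLpos.le
    have h2 : (M : ℝ) ^ n k * a (sch.β k) * (2 * (sch.L k : ℝ) + 1) ≤ (M : ℝ) ^ n k * ℓ₀ := by
      have := mul_le_mul_of_nonneg_left hfem' hDpos.le
      linarith
    have h3 : (M : ℝ) ^ n k * ℓ₀ < δ * (2 * (sch.L k : ℝ) + 1) := by
      nlinarith [mul_pos (sub_pos.2 hδN) hDpos,
        mul_le_mul_of_nonneg_left hkN' (by positivity : (0 : ℝ) ≤ 2 * δ)]
    linarith
  -- … forcing the rescaled correlator below `θ / 2`, contradiction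
  have hlt := hsmall (sch.side k) (sch.β k) (M ^ n k) hk₀ hfem hD0 hDS hsδ
  rw [hcast] at hlt
  linarith

end Summit.QuantumFields.YangMills.Theorems.TunedSequenceExists.QFemto

end
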